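import Summits.AnomalousDissipation.AnomalousDissipation.Theses.TwoAndHalfD
import Literature.Analysis.FluidPDE.TwoHalfSection
import Literature.Analysis.FluidPDE.TwoHalfNavierStokes
import Literature.Analysis.FluidPDE.TwoHalfWeakEuler
import Literature.Analysis.FunctionSpaces.TorusWeakFormBookkeeping
import Summits.AnomalousDissipation.AnomalousDissipation.Theorems.TwohalfdNeg.Negative.LaminarShear

/-!
# Negative knowledge for the crux `TwohalfdThesis` (stmt-AnomalousDissipation-0206), IV: descent of the weak formulation of an
# `x₃`-invariant Navier–Stokes solution to its planar part (first instalment towards the gap `PlanarDescentEnergyEq`)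

Certified copy of the cdisprove cycle-2 work file `Descent.lean` (route `TwoAndHalfD`, target `X := TwohalfdThesis`).  The gap
named in `Negative/PlanarForceOfDescent.lean` (`PlanarDescentEnergyEq`: the planar part of an `x₃`-invariant global Leray–Hopf
solution driven by `(g,h)∘π` is a 2-D Leray–Hopf solution driven by `g`, with the long-time energy budget) has a bookkeeping
half and an analytic half (the component-wise energy inequality).  This file proves the core of the bookkeeping half:

* `Descent.isWeakNSSolutionForcedOn_planarPart` — **if `u` is an `x₃`-invariant weak (pressure-free) Navier–Stokes solution on
  `T³ × [0,T)` (`Torus.IsWeakNSSolutionForcedOn`) with force `(g,h)∘π`, `x₃`-invariant datum, and `L²` slices on `[0,T]`, then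
  its planar part `t ↦ (u₁,u₂)(t,·,0)` is a weak solution of the 2-D system on `T² × [0,T)` with force `g` from the planar
  part of the datum** (Bardos–Lopes Filho–Niu–Nussenzveig Lopes–Titi 2013 §2; Majda–Bertozzi 2002 §2.3.1): test the 3-D
  identity with the lift `(ψ₂,0)∘π` of a planar divergence-free test field (`isSpaceTimeTest_twoHalf_zero`,
  `isDivFreeTest_twoHalf_zero`) and descend term by term — `timeDeriv_lift` (`∂ₜ` commutes with the lift),
  `integral_inner_convect_lift`, `integral_inner_laplacian_lift`, `integral_inner_force_lift`, `integral_inner_lift` (pairings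
  of an invariant `L²` field with lifted planar data only see the planar part; tree: `TwoHalfSection`, `TwoHalfWeakEuler`);
  measurability / `L²ₜ,ₓ` / a.e. weak incompressibility of the planar part are `aestronglyMeasurable_stLift_planarPart`,
  `lintegral_lintegral_enorm_sq_planarPart_lt_top`, `ae_isWeaklyDivFree_planarPart`.
What remains of the gap: the other Leray–Hopf clauses of the planar part (routine, from `TwoHalfSection`/`TwoHalfSpectralSplit`)
and the component-wise energy inequality (the analytic half).  Supports stmt-AnomalousDissipation-0206.
-/

noncomputable section

namespace Summit.AnomalousDissipation.AnomalousDissipation.Theorems.TwohalfdThesis.Negative.Descent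

open MeasureTheory Set Filter Topology UnitAddTorus Function
open scoped ENNReal NNReal InnerProductSpace
open Literature.Analysis.FunctionSpaces Literature.Analysis.FunctionSpaces.Torus
open Literature.Analysis.FluidPDE Literature.Analysis.FluidPDE.Torus
open Summit.AnomalousDissipation.AnomalousDissipation.Theorems.TwohalfdNeg.Negative

/-- Local notation: the flat unit three-torus. -/
local notation "𝕋³" => UnitAddTorus (Fin 3)
/-- Local notation: velocity values on `T³`. -/
local notation "E³" => EuclideanSpace ℝ (Fin 3)
/-- Local notation: the flat unit two-torus. -/
local notation "𝕋²" => UnitAddTorus (Fin 2)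
/-- Local notation: velocity values on `T²`. -/
local notation "E²" => EuclideanSpace ℝ (Fin 2)

/-- The planar part `y ↦ (U₁,U₂)(y,0)` of a field on `T³` (agrees with `Negative.planarPart` by `rfl`). -/
def planarPart (U : 𝕋³ → E³) : 𝕋² → E² := fun y => planarProjE (U (planarSect y))
/-- The vertical part `y ↦ U₃(y,0)` of a field on `T³`. -/
def verticalPart (U : 𝕋³ → E³) : 𝕋² → ℝ := fun y => U (planarSect y) 2

variable {T : ℝ} {ψ : ℝ → 𝕋² → E²}

/-- **Lift of planar test fields**: `t ↦ (ψ t, 0)∘π` is a space–time test field on `T³`. [folklore] -/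
theorem isSpaceTimeTest_twoHalf_zero (hψ : IsSpaceTimeTest T ψ) :
    IsSpaceTimeTest T (fun t => twoHalf (ψ t) (0 : 𝕋² → ℝ)) := by
  obtain ⟨hs, T', hT', h0⟩ := hψ
  refine ⟨?_, T', hT', fun t ht => ?_⟩
  · have h1 : Torus.IsSmoothSpaceTimeOn univ ψ := by
      unfold Torus.IsSmoothSpaceTimeOn
      rw [Set.univ_prod_univ]
      exact hs.contDiffOn
    have h2 : Torus.IsSmoothSpaceTimeOn univ (fun (_ : ℝ) (_ : 𝕋²) => (0 : ℝ)) :=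
      isSmoothSpaceTimeOn_const (isSmooth_const _) _
    have h3 := h1.twoHalf h2
    unfold Torus.IsSmoothSpaceTimeOn at h3
    rw [Set.univ_prod_univ] at h3
    exact contDiffOn_univ.1 h3
  · funext x
    show twoHalf (ψ t) 0 x = 0
    rw [h0 t ht]
    simp only [twoHalf, Pi.zero_apply]
    exact (map_zero planarEmbed : planarEmbed ((0 : E²), (0 : ℝ)) = 0)

/-- The lift of a divergence-free planar test field is divergence free. [folklore] -/
theorem isDivFreeTest_twoHalf_zero (hψ : IsDivFreeTest ψ) :
    IsDivFreeTest (fun t => twoHalf (ψ t) (0 : 𝕋² → ℝ)) := fun t =>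
  IsDivFree.twoHalf (hψ t) _


/-! ## Slice identities for the lift `Ψ = (ψ₂, 0)∘π` paired with an invariant field -/

section Slices

variable {U : 𝕋³ → E³} {ψ₂ : 𝕋² → E²}

/-- An `x₃`-invariant field is the lift of its parts. [folklore] -/
theorem eq_twoHalf_parts (hU : ∀ (s : UnitAddCircle) (x : 𝕋³), U (x + Pi.single (2 : Fin 3) s) = U x) :
    U = twoHalf (planarPart U) (verticalPart U) :=
  eq_twoHalf_of_forall_add_single' hU

/-- The parts of an `x₃`-invariant `L²` field are `L²`. [folklore] -/
theorem memLp_parts (hU : ∀ (s : UnitAddCircle) (x : 𝕋³), U (x + Pi.single (2 : Fin 3) s) = U x)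
    (h2 : MemLp U 2 volume) : MemLp (planarPart U) 2 volume ∧ MemLp (verticalPart U) 2 volume := by
  rw [eq_twoHalf_parts hU] at h2
  exact memLp_of_twoHalf h2

/-- **Pairing with a lifted planar field**: `∫⟪U, (W,0)∘π⟫ = ∫⟪v, W⟫`. [folklore] -/
theorem integral_inner_lift (hU : ∀ (s : UnitAddCircle) (x : 𝕋³), U (x + Pi.single (2 : Fin 3) s) = U x)
    (h2 : MemLp U 2 volume) {W : 𝕋² → E²} (hW : MemLp W 2 volume) :
    ∫ x, ⟪U x, twoHalf W 0 x⟫_ℝ = ∫ y, ⟪planarPart U y, W y⟫_ℝ := by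
  obtain ⟨hV, -⟩ := memLp_parts hU h2
  conv_lhs => rw [eq_twoHalf_parts hU]
  exact integral_inner_twoHalf_planar hV hW _

/-- **The viscous term descends**: `∫⟪U, Δ((ψ₂,0)∘π)⟫ = ∫⟪v, Δψ₂⟫`. [folklore] -/
theorem integral_inner_laplacian_lift (hU : ∀ (s : UnitAddCircle) (x : 𝕋³), U (x + Pi.single (2 : Fin 3) s) = U x)
    (h2 : MemLp U 2 volume) (hψ : IsSmooth ψ₂) :
    ∫ x, ⟪U x, Torus.laplacian (twoHalf ψ₂ (0 : 𝕋² → ℝ)) x⟫_ℝ = ∫ y, ⟪planarPart U y, Torus.laplacian ψ₂ y⟫_ℝ := by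
  have hz : IsSmooth (0 : 𝕋² → ℝ) := isSmooth_const (0 : ℝ)
  rw [laplacian_twoHalf hψ hz]
  have h0 : Torus.laplacian (0 : 𝕋² → ℝ) = 0 := by
    funext y
    have h : liftAt (0 : 𝕋² → ℝ) y = fun _ => (0 : ℝ) := rfl
    simp only [Torus.laplacian, h, Pi.zero_apply]
    rw [InnerProductSpace.laplacian_const]
    rfl
  rw [h0]
  exact integral_inner_lift hU h2 (hψ.laplacian.memLp 2)

/-- **The force term descends**: `∫⟪(g,h)∘π, (ψ₂,0)∘π⟫ = ∫⟪g, ψ₂⟫`. [folklore] -/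
theorem integral_inner_force_lift {g : 𝕋² → E²} {h : 𝕋² → ℝ} (hg : MemLp g 2 volume) (hψ : MemLp ψ₂ 2 volume) :
    ∫ x, ⟪twoHalf g h x, twoHalf ψ₂ 0 x⟫_ℝ = ∫ y, ⟪g y, ψ₂ y⟫_ℝ :=
  integral_inner_twoHalf_planar hg hψ h

end Slices


/-! ## The first three conjuncts of the planar weak formulation -/

section Conjuncts

variable {T : ℝ} {u : ℝ → 𝕋³ → E³}

/-- An `x₃`-invariant time-dependent field is the lift of its parts (as functions of time). [folklore] -/
theorem eq_twoHalf_parts_fun (hinv : ∀ (t : ℝ) (s : UnitAddCircle) (x : 𝕋³), u t (x + Pi.single (2 : Fin 3) s) = u t x) :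
    u = fun t => twoHalf (planarPart (u t)) (verticalPart (u t)) :=
  funext fun t => eq_twoHalf_parts (hinv t)

/-- **(1) Measurability of the planar part.** [folklore] -/
theorem aestronglyMeasurable_stLift_planarPart
    (hinv : ∀ (t : ℝ) (s : UnitAddCircle) (x : 𝕋³), u t (x + Pi.single (2 : Fin 3) s) = u t x)
    (hm : AEStronglyMeasurable (stLift u) (volume.restrict (Ioo 0 T ×ˢ univ))) :
    AEStronglyMeasurable (stLift fun t => planarPart (u t))
      (volume.restrict (Ioo 0 T ×ˢ (univ : Set (EuclideanSpace ℝ (Fin 2))))) := by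
  rw [eq_twoHalf_parts_fun hinv] at hm
  exact (aestronglyMeasurable_stLift_of_twoHalf hm).1

/-- **(2) Square integrability of the planar part** on `(0,T) × T²`. [folklore] -/
theorem lintegral_lintegral_enorm_sq_planarPart_lt_top
    (hinv : ∀ (t : ℝ) (s : UnitAddCircle) (x : 𝕋³), u t (x + Pi.single (2 : Fin 3) s) = u t x)
    (hL2 : ∫⁻ t in Ioo 0 T, ∫⁻ x, ‖u t x‖ₑ ^ 2 < ∞) :
    ∫⁻ t in Ioo 0 T, ∫⁻ y, ‖planarPart (u t) y‖ₑ ^ 2 < ∞ := by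
  refine lt_of_le_of_lt (lintegral_mono fun t => ?_) hL2
  conv_rhs => rw [eq_twoHalf_parts (hinv t)]
  exact lintegral_enorm_sq_left_le_twoHalf _ _

/-- **(3) Weak incompressibility of the planar part**, a.e. in time. [folklore] -/
theorem ae_isWeaklyDivFree_planarPart
    (hinv : ∀ (t : ℝ) (s : UnitAddCircle) (x : 𝕋³), u t (x + Pi.single (2 : Fin 3) s) = u t x)
    (h2 : ∀ t ∈ Icc 0 T, MemLp (u t) 2 volume)
    (hdiv : ∀ᵐ t ∂(volume.restrict (Ioo 0 T)), IsWeaklyDivFree (u t)) :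
    ∀ᵐ t ∂(volume.restrict (Ioo 0 T)), IsWeaklyDivFree (planarPart (u t)) := by
  filter_upwards [hdiv, ae_restrict_mem measurableSet_Ioo] with t ht htI
  have hV := (memLp_parts (hinv t) (h2 t (Ioo_subset_Icc_self htI))).1
  rw [eq_twoHalf_parts (hinv t)] at ht
  exact isWeaklyDivFree_of_twoHalf hV ht

end Conjuncts


/-! ## Time derivative of the lifted test field -/

section TimeDeriv

variable {T : ℝ} {ψ₂ : ℝ → 𝕋² → E²}

/-- **`∂ₜ((ψ₂,0)∘π) = (∂ₜψ₂, 0)∘π`.** [folklore] -/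
theorem timeDeriv_lift (hψ : IsSpaceTimeTest T ψ₂) (t : ℝ) :
    Literature.Analysis.FunctionSpaces.Torus.timeDeriv (fun τ => twoHalf (ψ₂ τ) (0 : 𝕋² → ℝ)) t =
      twoHalf (Literature.Analysis.FunctionSpaces.Torus.timeDeriv ψ₂ t) (0 : 𝕋² → ℝ) := by
  funext x
  have hd : HasDerivAt (fun τ => ψ₂ τ (planarProj x)) (Literature.Analysis.FunctionSpaces.Torus.timeDeriv ψ₂ t (planarProj x)) t :=
    hasDerivAt_slice_timeDeriv hψ.1 t _
  have hp : HasDerivAt (fun τ => (ψ₂ τ (planarProj x), (0 : ℝ)))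
      (Literature.Analysis.FunctionSpaces.Torus.timeDeriv ψ₂ t (planarProj x), (0 : ℝ)) t :=
    hd.prodMk (hasDerivAt_const t (0 : ℝ))
  have h := (planarEmbed.hasFDerivAt.comp_hasDerivAt t hp).deriv
  simp only [Literature.Analysis.FunctionSpaces.Torus.timeDeriv]
  exact h

end TimeDeriv


/-! ## The convective term of the lifted test field -/

section Convect

variable {T : ℝ} {ψ₂ : ℝ → 𝕋² → E²} {U : 𝕋³ → E³}

/-- **The convective term descends**: `∫⟪U, (U·∇)((ψ₂ t,0)∘π)⟫ = ∫⟪v, (v·∇)(ψ₂ t)⟫`. [folklore] -/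
theorem integral_inner_convect_lift (hψ : IsSpaceTimeTest T ψ₂) (t : ℝ)
    (hU : ∀ (s : UnitAddCircle) (x : 𝕋³), U (x + Pi.single (2 : Fin 3) s) = U x) (h2 : MemLp U 2 volume) :
    ∫ x, ⟪U x, Torus.convect U (twoHalf (ψ₂ t) (0 : 𝕋² → ℝ)) x⟫_ℝ =
      ∫ y, ⟪planarPart U y, Torus.convect (planarPart U) (ψ₂ t) y⟫_ℝ := by
  obtain ⟨hV, hR⟩ := memLp_parts hU h2
  conv_lhs => rw [eq_twoHalf_parts hU]
  have hz : IsContDiff 1 (0 : 𝕋² → ℝ) := (isSmooth_const (0 : ℝ)).isContDiff (by simp)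
  have hW : IsContDiff 1 (ψ₂ t) := (hψ.isSmooth_slice t).isContDiff (by simp)
  have hg0 : ∀ y : 𝕋², Torus.gradient (0 : 𝕋² → ℝ) y = 0 := fun y => gradient_zero₂ y
  have h2' : Integrable (fun y => verticalPart U y * ⟪planarPart U y, Torus.gradient (0 : 𝕋² → ℝ) y⟫_ℝ) volume := by
    have : (fun y => verticalPart U y * ⟪planarPart U y, Torus.gradient (0 : 𝕋² → ℝ) y⟫_ℝ) = fun _ => 0 := by
      funext y
      rw [hg0 y, inner_zero_right, mul_zero]
    rw [this]
    exact integrable_const _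
  rw [integral_inner_twoHalf_convect_eq_add hW hz
    (integrable_inner_convect_slice (U := fun _ => planarPart U) hψ hV) h2']
  have : (∫ y, verticalPart U y * ⟪planarPart U y, Torus.gradient (0 : 𝕋² → ℝ) y⟫_ℝ) = 0 := by
    simp_rw [hg0, inner_zero_right, mul_zero, integral_zero]
  rw [this, add_zero]

end Convect

/-- **PART A1 — DESCENT OF THE WEAK FORMULATION TO THE PLANAR PART.**  If `u` is an `x₃`-invariant weak (pressure-free)
Navier–Stokes solution on `T³ × [0,T)` driven by the `x₃`-invariant force `(g,h)∘π` with `x₃`-invariant datum `u₀` (all slices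
`L²` on `[0,T]`), then its planar part `v = (u₁,u₂)(·,0)` is a weak solution of the 2-D system driven by `g` from the planar part
of the datum: test the 3-D identity with the lift `(ψ₂, 0)∘π` of a planar test field and descend term by term
(`timeDeriv_lift`, `integral_inner_convect_lift`, `integral_inner_laplacian_lift`, `integral_inner_force_lift`, `integral_inner_lift`).
(Bardos–Lopes Filho–Niu–Nussenzveig Lopes–Titi 2013, §2; Majda–Bertozzi 2002, §2.3.1.) [folklore] -/
theorem isWeakNSSolutionForcedOn_planarPart {ν : ℝ} {g : 𝕋² → E²} {h : 𝕋² → ℝ} {u₀ : 𝕋³ → E³} {u : ℝ → 𝕋³ → E³}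
    (hw : IsWeakNSSolutionForcedOn T ν (fun _ => twoHalf g h) u₀ u)
    (hinv₀ : ∀ (s : UnitAddCircle) (x : 𝕋³), u₀ (x + Pi.single (2 : Fin 3) s) = u₀ x)
    (hinv : ∀ (t : ℝ) (s : UnitAddCircle) (x : 𝕋³), u t (x + Pi.single (2 : Fin 3) s) = u t x)
    (h2₀ : MemLp u₀ 2 volume) (h2 : ∀ t ∈ Icc 0 T, MemLp (u t) 2 volume) (hg : IsSmooth g) (hh : IsSmooth h) :
    IsWeakNSSolutionForcedOn T ν (fun _ => g) (planarPart u₀) (fun t => planarPart (u t)) := by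
  obtain ⟨hm, hL2, hdiv, hid⟩ := hw
  refine ⟨aestronglyMeasurable_stLift_planarPart hinv hm, lintegral_lintegral_enorm_sq_planarPart_lt_top hinv hL2,
    ae_isWeaklyDivFree_planarPart hinv h2 hdiv, fun ψ₂ hψ hψdiv => ?_⟩
  have hΨ : IsSpaceTimeTest T (fun t => twoHalf (ψ₂ t) (0 : 𝕋² → ℝ)) := isSpaceTimeTest_twoHalf_zero hψ
  have hΨdiv : IsDivFreeTest (fun t => twoHalf (ψ₂ t) (0 : 𝕋² → ℝ)) := isDivFreeTest_twoHalf_zero hψdiv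
  have h3 := hid (fun t => twoHalf (ψ₂ t) (0 : 𝕋² → ℝ)) hΨ hΨdiv
  have hF : IsSmooth (twoHalf g h) := hg.twoHalf hh
  -- the slice identity
  have hslice : ∀ t ∈ Ioo 0 T,
      (∫ x, (⟪u t x, Literature.Analysis.FunctionSpaces.Torus.timeDeriv (fun t => twoHalf (ψ₂ t) (0 : 𝕋² → ℝ)) t x⟫_ℝ +
          ⟪u t x, Torus.convect (u t) ((fun t => twoHalf (ψ₂ t) (0 : 𝕋² → ℝ)) t) x⟫_ℝ +
          ν * ⟪u t x, Torus.laplacian ((fun t => twoHalf (ψ₂ t) (0 : 𝕋² → ℝ)) t) x⟫_ℝ +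
          ⟪(fun _ : ℝ => twoHalf g h) t x, (fun t => twoHalf (ψ₂ t) (0 : 𝕋² → ℝ)) t x⟫_ℝ)) =
        ∫ y, (⟪(fun t => planarPart (u t)) t y, Literature.Analysis.FunctionSpaces.Torus.timeDeriv ψ₂ t y⟫_ℝ +
          ⟪(fun t => planarPart (u t)) t y, Torus.convect ((fun t => planarPart (u t)) t) (ψ₂ t) y⟫_ℝ +
          ν * ⟪(fun t => planarPart (u t)) t y, Torus.laplacian (ψ₂ t) y⟫_ℝ +
          ⟪(fun _ : ℝ => g) t y, ψ₂ t y⟫_ℝ) := by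
    intro t ht
    have hut : MemLp (u t) 2 volume := h2 t (Ioo_subset_Icc_self ht)
    have hvt : MemLp (planarPart (u t)) 2 volume := (memLp_parts (hinv t) hut).1
    -- integrability of the 3-D slice terms
    have iA := integrable_inner_timeDeriv_slice (U := u) hΨ hut
    have iB := integrable_inner_convect_slice (U := u) hΨ hut
    have iC : Integrable (fun x => ν * ⟪u t x, Torus.laplacian (twoHalf (ψ₂ t) (0 : 𝕋² → ℝ)) x⟫_ℝ) volume :=
      (integrable_inner_of_memLp_two hut ((hΨ.isSmooth_slice t).laplacian.memLp 2)).const_mul ν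
    have iD : Integrable (fun x => ⟪twoHalf g h x, twoHalf (ψ₂ t) (0 : 𝕋² → ℝ) x⟫_ℝ) volume :=
      integrable_inner_of_memLp_two (hF.memLp 2) ((hΨ.isSmooth_slice t).memLp 2)
    -- integrability of the 2-D slice terms
    have jA := integrable_inner_timeDeriv_slice (U := fun t => planarPart (u t)) hψ hvt
    have jB := integrable_inner_convect_slice (U := fun t => planarPart (u t)) hψ hvt
    have jC : Integrable (fun y => ν * ⟪planarPart (u t) y, Torus.laplacian (ψ₂ t) y⟫_ℝ) volume :=
      (integrable_inner_of_memLp_two hvt ((hψ.isSmooth_slice t).laplacian.memLp 2)).const_mul ν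
    have jD : Integrable (fun y => ⟪g y, ψ₂ t y⟫_ℝ) volume :=
      integrable_inner_of_memLp_two (hg.memLp 2) ((hψ.isSmooth_slice t).memLp 2)
    -- the four descended terms
    have eA : ∫ x, ⟪u t x, Literature.Analysis.FunctionSpaces.Torus.timeDeriv (fun t => twoHalf (ψ₂ t) (0 : 𝕋² → ℝ)) t x⟫_ℝ =
        ∫ y, ⟪planarPart (u t) y, Literature.Analysis.FunctionSpaces.Torus.timeDeriv ψ₂ t y⟫_ℝ := by
      rw [timeDeriv_lift hψ t]
      exact integral_inner_lift (hinv t) hut ((hψ.timeDeriv.isSmooth_slice t).memLp 2)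
    have eB := integral_inner_convect_lift hψ t (hinv t) hut
    have eC : ∫ x, ν * ⟪u t x, Torus.laplacian (twoHalf (ψ₂ t) (0 : 𝕋² → ℝ)) x⟫_ℝ =
        ∫ y, ν * ⟪planarPart (u t) y, Torus.laplacian (ψ₂ t) y⟫_ℝ := by
      rw [integral_const_mul, integral_const_mul, integral_inner_laplacian_lift (hinv t) hut (hψ.isSmooth_slice t)]
    have eD : ∫ x, ⟪twoHalf g h x, twoHalf (ψ₂ t) (0 : 𝕋² → ℝ) x⟫_ℝ = ∫ y, ⟪g y, ψ₂ t y⟫_ℝ :=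
      integral_inner_force_lift (hg.memLp 2) ((hψ.isSmooth_slice t).memLp 2)
    -- split, descend, recombine
    show (∫ x, (⟪u t x, Literature.Analysis.FunctionSpaces.Torus.timeDeriv (fun t => twoHalf (ψ₂ t) (0 : 𝕋² → ℝ)) t x⟫_ℝ +
          ⟪u t x, Torus.convect (u t) (twoHalf (ψ₂ t) (0 : 𝕋² → ℝ)) x⟫_ℝ +
          ν * ⟪u t x, Torus.laplacian (twoHalf (ψ₂ t) (0 : 𝕋² → ℝ)) x⟫_ℝ +
          ⟪twoHalf g h x, twoHalf (ψ₂ t) (0 : 𝕋² → ℝ) x⟫_ℝ)) =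
        ∫ y, (⟪planarPart (u t) y, Literature.Analysis.FunctionSpaces.Torus.timeDeriv ψ₂ t y⟫_ℝ +
          ⟪planarPart (u t) y, Torus.convect (planarPart (u t)) (ψ₂ t) y⟫_ℝ +
          ν * ⟪planarPart (u t) y, Torus.laplacian (ψ₂ t) y⟫_ℝ + ⟪g y, ψ₂ t y⟫_ℝ)
    have iAB : Integrable (fun x => ⟪u t x, Literature.Analysis.FunctionSpaces.Torus.timeDeriv (fun t => twoHalf (ψ₂ t) (0 : 𝕋² → ℝ)) t x⟫_ℝ +
        ⟪u t x, Torus.convect (u t) (twoHalf (ψ₂ t) (0 : 𝕋² → ℝ)) x⟫_ℝ) volume := iA.add iB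
    have iABC : Integrable (fun x => ⟪u t x, Literature.Analysis.FunctionSpaces.Torus.timeDeriv (fun t => twoHalf (ψ₂ t) (0 : 𝕋² → ℝ)) t x⟫_ℝ +
        ⟪u t x, Torus.convect (u t) (twoHalf (ψ₂ t) (0 : 𝕋² → ℝ)) x⟫_ℝ +
        ν * ⟪u t x, Torus.laplacian (twoHalf (ψ₂ t) (0 : 𝕋² → ℝ)) x⟫_ℝ) volume := iAB.add iC
    have jAB : Integrable (fun y => ⟪planarPart (u t) y, Literature.Analysis.FunctionSpaces.Torus.timeDeriv ψ₂ t y⟫_ℝ +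
        ⟪planarPart (u t) y, Torus.convect (planarPart (u t)) (ψ₂ t) y⟫_ℝ) volume := jA.add jB
    have jABC : Integrable (fun y => ⟪planarPart (u t) y, Literature.Analysis.FunctionSpaces.Torus.timeDeriv ψ₂ t y⟫_ℝ +
        ⟪planarPart (u t) y, Torus.convect (planarPart (u t)) (ψ₂ t) y⟫_ℝ +
        ν * ⟪planarPart (u t) y, Torus.laplacian (ψ₂ t) y⟫_ℝ) volume := jAB.add jC
    rw [integral_add iABC iD, integral_add iAB iC, integral_add iA iB,
      integral_add jABC jD, integral_add jAB jC, integral_add jA jB, eA, eB, eC, eD]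
  -- the datum term
  have hdatum : ∫ x, ⟪u₀ x, (fun t => twoHalf (ψ₂ t) (0 : 𝕋² → ℝ)) 0 x⟫_ℝ = ∫ y, ⟪planarPart u₀ y, ψ₂ 0 y⟫_ℝ :=
    integral_inner_lift hinv₀ h2₀ ((hψ.isSmooth_slice 0).memLp 2)
  rw [setIntegral_congr_fun measurableSet_Ioo hslice, hdatum] at h3
  exact h3

end Summit.AnomalousDissipation.AnomalousDissipation.Theorems.TwohalfdThesis.Negative.Descent

end
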